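import Literature.NumberTheory.GaloisCohomology.Howard2004.DVRSettingEngineStub
import Literature.Algebra.Module.PairedTorsionModulesSmallSocle
import HarnessLib

/-!
# Howard 2004, Lemma 1.6.4 on a `DVRSetting`: the engine hypothesis `hsmall` —
# «`ρ(n) = 0` or `1` implies `Stub^{(k)}(n) = H¹_{F(n)}(K, T^{(k)})`» (proofs file, ENGINE-hsmall)

Topic `NumberTheory/GaloisCohomology/Howard2004` (sequel to `DVRSettingEngineStub` — the engine's data `H k n =
selmerModuleAt`, `Stub k n = stub`, `stubLength`, `HasLevelDecompositions`, `enginePrimes` — and to the algebra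
`Literature/Algebra/Module/PairedTorsionModulesSmallSocle`).  THEOREMS ONLY: no definition, no named fact, no
instance, no `sorry`.

B. Howard, *The Heegner point Kolyvagin system*, Compositio Math. **140** (2004), proof of Lemma 1.6.4
(arXiv:1202.6340 p. 12 L10–13): «By Lemma (H.5 application), `ρ(n) = 0` or `1` implies that
`Stub^{(k)}(n) = H¹_{𝓕(n)}(K, T^{(k)})`», with `H¹_{𝓕(n)}(K, T^{(k)}) ≅ R^{(k),ε} ⊕ M ⊕ M` (Thm. 1.4.2),
`Stub^{(k)}(n) = 𝔪^{len M} H¹_{𝓕(n)}(K, T^{(k)})` (Def. 1.5.4) and `ρ(n) = dim H¹_{𝓕(n)}(K, T^{(k)})[𝔪] = ε + 2 dim M[𝔪]`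
(Lemma 1.3.3, Prop. 1.5.5).  This file discharges the binder
`hsmall : ∀ k n, ↑n ⊆ P k → ρp k n + ρm k n ≤ 1 → Stub k n = ⊤` of the induction ENGINE
(`StubLemmaInductionProofs.mem_stub_of_stubLemmaInduction_levels'`, instantiated on a `DVRSetting` by
`DVRSettingEngineData` / `DVRSettingEngineStub`) MODULO the comparison of `ρ⁺ + ρ⁻` with the `𝔪`-torsion dimension
of the level Selmer group (Lemma 1.3.3 for `T̄`, the Galois side's `ρ(n) = dim_{R/𝔪} H¹_{F(n)}(K, T^{(k)})[𝔪]`):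

* `exists_linearEquiv_of_addEquiv_of_smul` (§0, the additive `R`-equivariant `θ` read `R`-linearly),
  `exists_linearEquiv_decomposition` — the CHOSEN decomposition of
  `HasLevelDecompositions` at `(k, n)`, upgraded to an `R`-LINEAR equivalence on `selmerModuleAt` (its equivariance
  clause), with `stubLength = len_R M` and `M` `π`-primary;
* **`stub_eq_top_of_finrank_torsionBy_le_one`** — `dim_{R/(π)} H¹_{F(n)}(K, T^{(k)})[π] ≤ 1 ⟹ Stub^{(k)}(n) = ⊤`
  (the algebra `pow_length_smul_top_eq_top_of_finrank_torsionBy_le_one` with `C = R/𝔪^{e_k}`, `dim C[π] = 1`);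
* **`hsmall_of_finrank_le`** — the engine binder `hsmall` VERBATIM, for any `ρ±` dominating that dimension.
Cell `pub/bsd-print-x9`, G87 (print leaf `stub_h161` of stmt-BirchSwinnertonDyer-22642); seat `bsd-line-x9-p1-w3` g14,
brick (ENGINE-hsmall).  `thm161_dvrKolyvaginBound` is NOT proved; BSD is not proved by any of this.

References: [Howard2004HeegnerKolyvagin] Lemma 1.6.4 (proof), Def. 1.5.4, Prop. 1.5.5, Thm. 1.4.2; [Hungerford1974] IV.6.10.
-/

set_option autoImplicit false

noncomputable section

open Function NumberField IsDedekindDomain Field Module Submodule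
open scoped NumberField Classical Pointwise

namespace Literature.NumberTheory.GaloisCohomology.Howard2004

open Literature.NumberTheory.GaloisRepresentations
open Literature.NumberTheory.GaloisRepresentations.DiscreteGaloisModule
open Literature.Algebra.Module

namespace DVRSetting

variable {p : ℕ} [Fact p.Prime] {K : Type} [Field K] [NumberField K]
  {R : Type} [CommRing R] [IsDomain R] [IsDiscreteValuationRing R] [Algebra ℤ_[p] R]
  {N : ℕ → Type} [∀ k, AddCommGroup (N k)] [∀ k, TopologicalSpace (N k)]
  [∀ k, DiscreteTopology (N k)] [∀ k, Module R (N k)]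
  {Rk : ℕ → Type} [∀ k, CommRing (Rk k)] [∀ k, IsLocalRing (Rk k)] [∀ k, TopologicalSpace (Rk k)]
  [∀ k, DiscreteTopology (Rk k)] [∀ k, Algebra ℤ_[p] (Rk k)] [∀ k, Algebra R (Rk k)]
  [∀ k, Module (Rk k) (N k)] [∀ k, IsScalarTower R (Rk k) (N k)]
  {Nbar : Type} [AddCommGroup Nbar] [TopologicalSpace Nbar] [DiscreteTopology Nbar]
  [∀ k, Module (Rk k) Nbar]
  {Nq : ℕ → Finset (HeightOneSpectrum (𝓞 K)) → Type} [∀ k n, AddCommGroup (Nq k n)]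
  [∀ k n, TopologicalSpace (Nq k n)] [∀ k n, DiscreteTopology (Nq k n)]
  [∀ k n, Module (Rk k) (Nq k n)] [∀ k n, Module R (Nq k n)]
  [∀ k n, IsScalarTower R (Rk k) (Nq k n)]

/-! ## §0 An additive, `R`-equivariant bijection on a subgroup carrying an `R`-submodule is `R`-linear -/

omit [IsDomain R] [IsDiscreteValuationRing R] in
/-- **An additive `R`-equivariant bijection `θ : G ≃+ P` on a subgroup `G` that is the carrier of an `R`-submodule
`W` (the scalars acting through `φ r = (r • ·)`, `θ (φ r y) = r • θ y`) is an `R`-LINEAR equivalence `W ≃ₗ[R] P`.**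
(How Thm. 1.4.2's «`R`-equivariant `θ`» of `HasLevelDecompositions` is read on the engine's `selmerModuleAt`.)
[cite: Howard2004HeegnerKolyvagin, Thm. 1.4.2 (arXiv:1202.6340 p. 8 L99–105: an isomorphism of `R`-modules)] -/
theorem exists_linearEquiv_of_addEquiv_of_smul {V P : Type} [AddCommGroup V] [Module R V] [AddCommGroup P]
    [Module R P] (W : Submodule R V) (G : AddSubgroup V) (hWG : ∀ x, x ∈ W ↔ x ∈ G) (φ : R → V → V)
    (hφ : ∀ (r : R) (y : V), r • y = φ r y) (hG : ∀ (r : R) (y : V), y ∈ G → φ r y ∈ G) (θ : ↥G ≃+ P)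
    (hθ : ∀ (r : R) (y : V) (hy : y ∈ G), θ ⟨φ r y, hG r y hy⟩ = r • θ ⟨y, hy⟩) :
    ∃ e : ↥W ≃ₗ[R] P, ∀ x : ↥W, e x = θ ⟨(x : V), (hWG _).1 x.2⟩ := by
  let ι : ↥W ≃+ ↥G :=
    { toFun := fun x => ⟨x.1, (hWG _).1 x.2⟩
      invFun := fun y => ⟨y.1, (hWG _).2 y.2⟩
      left_inv := fun _ => rfl
      right_inv := fun _ => rfl
      map_add' := fun _ _ => rfl }
  have hι : ∀ x : ↥W, ι x = ⟨x.1, (hWG _).1 x.2⟩ := fun _ => rfl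
  refine ⟨(ι.trans θ).toLinearEquiv fun r x => ?_, fun x => rfl⟩
  rw [AddEquiv.trans_apply, AddEquiv.trans_apply, hι, hι]
  have hx : (⟨((r • x : ↥W) : V), (hWG _).1 (r • x).2⟩ : ↥G) = ⟨φ r (x : V), hG r _ ((hWG _).1 x.2)⟩ := by
    apply Subtype.ext
    show ((r • x : ↥W) : V) = φ r (x : V)
    rw [Submodule.coe_smul, hφ]
  rw [hx, hθ]

/-! ## §1 The chosen decomposition as an `R`-linear equivalence -/

/-- **The CHOSEN decomposition `H¹_{F(n)}(K, T^{(k)}) ≃ₗ[R] (R/𝔪^{e_k})^ε × (M × M)` of `HasLevelDecompositions`**,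
`R`-LINEARLY on the engine's `selmerModuleAt` (the additive `θ` is `R`-equivariant by its defining clause), with
`ε ≤ 1`, `M` finite and `π`-primary, and `stubLength = len_R M` for this `M` (the one `stub` is built from).
[cite: Howard2004HeegnerKolyvagin, Thm. 1.4.2 and Def. 1.5.4 (arXiv:1202.6340 p. 8 L99–105, p. 10 L56–60)] -/
theorem exists_linearEquiv_decomposition (S : DVRSetting p K R N Rk Nbar Nq) (hy : S.SatisfiesH)
    (hdec : S.HasLevelDecompositions hy) (k : ℕ) (n : Finset (HeightOneSpectrum (𝓞 K)))
    (hn : ↑n ⊆ S.enginePrimes k) :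
    letI := galoisCohomology.moduleH1 (S.T.ρ k) (S.T.hlin k)
    ∃ (ε : ℕ) (_ : ε ≤ 1) (M : Type) (_ : AddCommGroup M) (_ : Module R M) (_ : Finite M),
      Nonempty (↥(S.selmerModuleAt hy k n) ≃ₗ[R] ((Fin ε → R ⧸ IsLocalRing.maximalIdeal R ^ S.e k) × (M × M))) ∧
      (∀ m : M, S.π ^ S.e k • m = 0) ∧ S.stubLength hy hdec k n = (Module.length R M).toNat := by
  letI := galoisCohomology.moduleH1 (S.T.ρ k) (S.T.hlin k)
  have h0 := hdec k n hn
  -- the chosen data, named exactly as in `stubLength`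
  let ε : ℕ := Classical.choose h0
  have hε : ε ≤ 1 := Classical.choose (Classical.choose_spec h0)
  let M : Type := Classical.choose (Classical.choose_spec (Classical.choose_spec h0))
  letI : AddCommGroup M :=
    Classical.choose (Classical.choose_spec (Classical.choose_spec (Classical.choose_spec h0)))
  letI : Module R M := Classical.choose
    (Classical.choose_spec (Classical.choose_spec (Classical.choose_spec (Classical.choose_spec h0))))
  haveI : Finite M := Classical.choose (Classical.choose_spec
    (Classical.choose_spec (Classical.choose_spec (Classical.choose_spec (Classical.choose_spec h0)))))
  let θ := Classical.choose (Classical.choose_spec (Classical.choose_spec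
    (Classical.choose_spec (Classical.choose_spec (Classical.choose_spec (Classical.choose_spec h0))))))
  have hθ := Classical.choose_spec (Classical.choose_spec (Classical.choose_spec
    (Classical.choose_spec (Classical.choose_spec (Classical.choose_spec (Classical.choose_spec h0))))))
  have hlen : S.stubLength hy hdec k n = (Module.length R M).toNat := by
    simp only [stubLength, dif_pos hn]
    rfl
  -- `θ` is `R`-linear on the `R`-submodule `selmerModuleAt` (same carrier as the Selmer group)
  obtain ⟨e, -⟩ := exists_linearEquiv_of_addEquiv_of_smul (R := R) (S.selmerModuleAt hy k n)
    ((((S.t k).atLevel S.jbar n).cond).selmerGroup) (fun x => S.mem_selmerModuleAt_iff hy k n x)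
    (fun r y => galoisCohomology.scalarMapH1 (S.T.ρ k) (S.T.hlin k) r y)
    (fun r y => galoisCohomology.smul_def (S.T.ρ k) (S.T.hlin k) r y)
    (fun r y hy' => S.scalarMapH1_mem_selmerGroup_atLevel hy k n r hy') θ (fun r y hy' => hθ r y hy')
  -- `M` is killed by `π^{e_k}` (it is a summand of a module killed by `π^{e_k}`)
  have hM : ∀ m : M, S.π ^ S.e k • m = 0 := fun m => by
    have hx : S.π ^ S.e k • e.symm (0, (m, 0)) = 0 :=
      Subtype.ext (S.pow_e_smul_eq_zero hy k _)
    have h := congrArg (fun z => (e z).2.1) hx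
    simp only [map_smul, LinearEquiv.apply_symm_apply, map_zero, Prod.smul_snd, Prod.smul_fst, Prod.snd_zero,
      Prod.fst_zero] at h
    exact h
  exact ⟨ε, hε, M, inferInstance, inferInstance, inferInstance, ⟨e⟩, hM, hlen⟩

/-! ## §2 `dim H¹_{F(n)}(K, T^{(k)})[π] ≤ 1 ⟹ Stub^{(k)}(n) = ⊤` -/

/-- **«`ρ(n) = 0` or `1` implies `Stub^{(k)}(n) = H¹_{𝓕(n)}(K, T^{(k)})`»** on a `DVRSetting` (engine currency): if the
`𝔪`-torsion of the level Selmer group has dimension `≤ 1` over `R/𝔪`, then `Stub^{(k)}(n) = ⊤` — the chosen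
decomposition has `dim H[π] = ε + 2·dim M[π]`, so `M[π] = 0`, `M = 0` (`π`-primary), `λ^{(k)}(n) = len M = 0` and
`Stub = 𝔪⁰·H = H`. [cite: Howard2004HeegnerKolyvagin, Lemma 1.6.4 (proof) with Prop. 1.5.5, Def. 1.5.4 (arXiv:1202.6340 p. 12 L10–13; p. 10 L56–75)] -/
theorem stub_eq_top_of_finrank_torsionBy_le_one (S : DVRSetting p K R N Rk Nbar Nq) (hy : S.SatisfiesH)
    (hdec : S.HasLevelDecompositions hy) (k : ℕ) (n : Finset (HeightOneSpectrum (𝓞 K)))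
    (hn : ↑n ⊆ S.enginePrimes k)
    (h : letI := galoisCohomology.moduleH1 (S.T.ρ k) (S.T.hlin k)
      Module.finrank (R ⧸ R ∙ S.π) ↥(torsionBy R ↥(S.selmerModuleAt hy k n) S.π) ≤ 1) :
    S.stub hy hdec k n = ⊤ := by
  letI := galoisCohomology.moduleH1 (S.T.ρ k) (S.T.hlin k)
  obtain ⟨ε, -, M, _, _, _, ⟨e⟩, hM, hlen⟩ := S.exists_linearEquiv_decomposition hy hdec k n hn
  have hϖ : Irreducible S.π := (IsDiscreteValuationRing.irreducible_iff_uniformizer S.π).mpr hy.unif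
  -- `R/𝔪^{e_k} = R/(π^{j+1})`, whose `π`-torsion is a line
  have h1e : 1 ≤ S.e k := le_trans (Nat.one_le_of_lt hy.e_zero) (hy.e_strictMono.monotone (Nat.zero_le k))
  obtain ⟨j, hj⟩ : ∃ j, S.e k = j + 1 := ⟨S.e k - 1, (Nat.sub_add_cancel h1e).symm⟩
  have hI : IsLocalRing.maximalIdeal R ^ S.e k = Ideal.span {S.π ^ (j + 1)} := by
    rw [hy.unif, Ideal.span_singleton_pow, hj]
  let eC : (R ⧸ IsLocalRing.maximalIdeal R ^ S.e k) ≃ₗ[R] (R ⧸ Ideal.span {S.π ^ (j + 1)}) :=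
    (Ideal.quotientEquivAlgOfEq R hI).toLinearEquiv
  let e' : ↥(S.selmerModuleAt hy k n) ≃ₗ[R] ((Fin ε → R ⧸ Ideal.span {S.π ^ (j + 1)}) × (M × M)) :=
    e.trans ((LinearEquiv.piCongrRight fun _ => eC).prodCongr (LinearEquiv.refl R (M × M)))
  haveI : Module.Finite R M := Module.Finite.of_finite
  have hM' : ∀ m : M, ∃ i : ℕ, S.π ^ i • m = 0 := fun m => ⟨S.e k, hM m⟩
  have key := pow_length_smul_top_eq_top_of_finrank_torsionBy_le_one hϖ
    (finrank_torsionBy_quotient_uniformizer_pow_succ hϖ j) hM' e' h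
  rw [stub, Submodule.ideal_span_singleton_smul, hlen]
  exact key

/-! ## §3 The engine binder `hsmall` -/

/-- **The ENGINE hypothesis `hsmall`, verbatim, for any eigen-lengths `ρ⁺, ρ⁻` dominating the `𝔪`-torsion
dimension** (`dim_{R/𝔪} H¹_{F(n)}(K, T^{(k)})[𝔪] ≤ ρ⁺(n) + ρ⁻(n)` — Howard: `=`, by Lemma 1.3.3
`H¹_{F(n)}(K, T̄) ≅ H¹_{F(n)}(K, T^{(k)})[𝔪]` and `ρ = ρ⁺ + ρ⁻`):
`∀ k n, ↑n ⊆ 𝓛^{(2k−1)} → ρ⁺ k n + ρ⁻ k n ≤ 1 → Stub^{(k)}(n) = ⊤`.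
[cite: Howard2004HeegnerKolyvagin, Lemma 1.6.4 (proof) (arXiv:1202.6340 p. 12 L10–13)] -/
theorem hsmall_of_finrank_le (S : DVRSetting p K R N Rk Nbar Nq) (hy : S.SatisfiesH)
    (hdec : S.HasLevelDecompositions hy) (ρp ρm : ℕ → Finset (HeightOneSpectrum (𝓞 K)) → ℕ)
    (hρ : ∀ (k : ℕ) (n : Finset (HeightOneSpectrum (𝓞 K))), ↑n ⊆ S.enginePrimes k →
      letI := galoisCohomology.moduleH1 (S.T.ρ k) (S.T.hlin k)
      Module.finrank (R ⧸ R ∙ S.π) ↥(torsionBy R ↥(S.selmerModuleAt hy k n) S.π) ≤ ρp k n + ρm k n) :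
    ∀ (k : ℕ) (n : Finset (HeightOneSpectrum (𝓞 K))), ↑n ⊆ S.enginePrimes k → ρp k n + ρm k n ≤ 1 →
      S.stub hy hdec k n = ⊤ :=
  fun k n hn hle => S.stub_eq_top_of_finrank_torsionBy_le_one hy hdec k n hn ((hρ k n hn).trans hle)

end DVRSetting

end Literature.NumberTheory.GaloisCohomology.Howard2004

end
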